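import Mathlib
import Summits.ValiantsHypothesis.ValiantsHypothesis.Theorems.NewtonTauWeak.Negative.Zonogon
import Summits.ValiantsHypothesis.ValiantsHypothesis.Theorems.NewtonUnitEquationsNewtonTauWeakResidueDesignT2
import Summits.ValiantsHypothesis.ValiantsHypothesis.Theorems.NewtonUnitEquationsNewtonTauWeakGradedDesignT2

/-!
# `NewtonUnitEquationsNewtonTauWeakCyclicT2Instance` — cyclic T2-instance: the binomial T2 bound controls every cyclically weighted level set

Registered stub `stub_cyclicT2Instance` of line `binomial-normal-form` (crux `NewtonTauWeak`, stmt-ValiantsHypothesis-5904, lead c6,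
namespace `RungC6` of `Cruxes/NewtonTauWeak/Lines/binomial_normal_form.lean`, wave 3 = stub-critic plan
`Cruxes/NewtonTauWeak/STUB-PLAN-stub_binomialNewtonTauCommon.md` Tier 1).

Setting.  A dissociated exponent list `d j ∈ ℕ²` (`j : Fin N`; all subset sums distinct), weights `g j ∈ ℕ`, a
modulus `q ≥ 1` and a residue `r`; the *cyclic (residue) level set* is
`X_{r mod q} = {Σ_{j∈J} d_j : Σ_{j∈J} g_j ≡ r (mod q)} ⊆ ℕ²`.  The hypothesis `hT2` is the binomial normal form
inequality T2 with a FIXED exponent `b`: a sum of `K` scalar multiples of products of `N` binomials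
`1 − ρ_{lj} X^{d_j}` over a common exponent list has at most `(K N + 2)^b` Newton vertices.

Claim (cyclic twin of `stub_levelSetOfT2`).  `#ext conv X_{r mod q} ≤ (q N + 2)^b`.

Proof.  Let `ζ` be a primitive `q`-th root of unity (`Complex.isPrimitiveRoot_exp`) and consider the
residue-ISOLATING cyclic design with `K = q` products
`f = Σ_{t<q} c_t Π_j (1 − (ζ^t)^{g_j} X^{d_j})`, `c_t = ζ^{−t r} / q`.
* (`CyclicT2InstanceAux.charSum_pow_eq`)  Character orthogonality (`ResidueDesignT2Aux.charSum_eq`):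
  `Σ_{t<q} ζ^{−t r} / q · (ζ^t)^n = [n ≡ r (mod q)]`.
* (`CyclicT2InstanceAux.coeff_cyclic_subsetSum`)  `f` is a graded design with nodes `u_t = ζ^t`, so at a subset
  sum `Σ_J d` only `T = J` contributes (dissociation) and the grading collects into one power
  (`GradedDesignT2Aux.coeff_graded_subsetSum`): `coeff_{Σ_J d} f = (−1)^{|J|} · [Σ_J g_j ≡ r (mod q)]`.
* (`CyclicT2InstanceAux.support_cyclic_design`)  Off the subset sums every expanded summand vanishes
  (`GradedDesignT2Aux.coeff_graded`), so `supp f` is EXACTLY the cyclic level set `X_{r mod q}`.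
* Hence `#ext conv X_{r mod q} = vert f ≤ (q N + 2)^b` by `hT2`.

Everything is folklore (character orthogonality, expansion of binomial products); no named facts, no citations,
no `def`s.
-/

-- Sub = Summit single-conjunct layout: the duplicated namespace component is mandated by the tree.
set_option linter.dupNamespace false

noncomputable section

open scoped BigOperators
open MvPolynomial
open Summit.ValiantsHypothesis.ValiantsHypothesis.Theorems.NewtonTauWeak.Negative (vert)

namespace Summit.ValiantsHypothesis.ValiantsHypothesis.Theorems.NewtonUnitEquationsNewtonTauWeak

namespace CyclicT2InstanceAux

/-- **Character orthogonality along a grading.**  For a primitive `q`-th root of unity `ζ` (`q ≥ 1`) and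
naturals `n r`, `Σ_{t < q} ζ^{−t r} / q · (ζ^t)^n = [n ≡ r (mod q)]` (`ResidueDesignT2Aux.charSum_eq` after
`(ζ^t)^n = ζ^{t n}`). [folklore] -/
theorem charSum_pow_eq (q : ℕ) (hq : 1 ≤ q) (ζ : ℂ) (hζ : IsPrimitiveRoot ζ q) (n r : ℕ) :
    ∑ t : Fin q, ζ⁻¹ ^ ((t : ℕ) * r) / (q : ℂ) * (ζ ^ (t : ℕ)) ^ n =
      if n % q = r % q then 1 else 0 := by
  rw [← ResidueDesignT2Aux.charSum_eq q hq ζ hζ n r]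
  exact Finset.sum_congr rfl fun t _ => by rw [← pow_mul]

/-- **Coefficient formula of the residue-isolating cyclic design on a dissociated frame.**  The design
`f = Σ_{t<q} ζ^{−t r}/q · Π_j (1 − (ζ^t)^{g_j} X^{d_j})` is a graded design with nodes `ζ^t`, so
`coeff_{Σ_J d} f = (−1)^{|J|} · Σ_t ζ^{−t r}/q · (ζ^t)^{Σ_J g_j} = (−1)^{|J|} · [Σ_J g_j ≡ r (mod q)]`
(`GradedDesignT2Aux.coeff_graded_subsetSum`, `charSum_pow_eq`). [folklore] -/
theorem coeff_cyclic_subsetSum {N q : ℕ} (hq : 1 ≤ q) (ζ : ℂ) (hζ : IsPrimitiveRoot ζ q) (r : ℕ)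
    (g : Fin N → ℕ) (d : Fin N → (Fin 2 →₀ ℕ))
    (hdis : ∀ J J' : Finset (Fin N), ∑ j ∈ J, d j = ∑ j ∈ J', d j → J = J') (J : Finset (Fin N)) :
    coeff (∑ j ∈ J, d j) (∑ t : Fin q, C (ζ⁻¹ ^ ((t : ℕ) * r) / (q : ℂ)) *
        ∏ j, (1 - C ((ζ ^ (t : ℕ)) ^ g j * 1) * monomial (d j) 1)) =
      (-1 : ℂ) ^ J.card * if (∑ j ∈ J, g j) % q = r % q then 1 else 0 := by
  rw [GradedDesignT2Aux.coeff_graded_subsetSum g (fun t : Fin q => ζ ^ (t : ℕ))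
    (fun t : Fin q => ζ⁻¹ ^ ((t : ℕ) * r) / (q : ℂ)) (fun _ => 1) d hdis J, charSum_pow_eq q hq ζ hζ _ r,
    Finset.prod_const]

/-- **Support of the residue-isolating cyclic design** = the cyclic level set
`{Σ_J d : Σ_J g_j ≡ r (mod q)}`: off the subset sums every raw summand vanishes (`GradedDesignT2Aux.coeff_graded`),
and at a subset sum the coefficient is `(−1)^{|J|} ≠ 0` times the residue indicator
(`coeff_cyclic_subsetSum`). [folklore] -/
theorem support_cyclic_design {N q : ℕ} (hq : 1 ≤ q) (ζ : ℂ) (hζ : IsPrimitiveRoot ζ q) (r : ℕ)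
    (g : Fin N → ℕ) (d : Fin N → (Fin 2 →₀ ℕ))
    (hdis : ∀ J J' : Finset (Fin N), ∑ j ∈ J, d j = ∑ j ∈ J', d j → J = J') :
    (∑ t : Fin q, C (ζ⁻¹ ^ ((t : ℕ) * r) / (q : ℂ)) *
        ∏ j, (1 - C ((ζ ^ (t : ℕ)) ^ g j * 1) * monomial (d j) 1)).support =
      ((Finset.univ.filter fun J : Finset (Fin N) => (∑ j ∈ J, g j) % q = r % q).image
        fun J => ∑ j ∈ J, d j : Finset (Fin 2 →₀ ℕ)) := by
  have hpow : ∀ J : Finset (Fin N), (-1 : ℂ) ^ J.card ≠ 0 := fun J =>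
    pow_ne_zero _ (neg_ne_zero.mpr one_ne_zero)
  ext e
  simp only [mem_support_iff, Finset.mem_image, Finset.mem_filter, Finset.mem_univ, true_and]
  constructor
  · intro he
    by_cases hex : ∃ J : Finset (Fin N), ∑ j ∈ J, d j = e
    · obtain ⟨J, rfl⟩ := hex
      rw [coeff_cyclic_subsetSum hq ζ hζ r g d hdis J] at he
      refine ⟨J, ?_, rfl⟩
      by_contra hJ
      exact he (by rw [if_neg hJ, mul_zero])
    · refine absurd ?_ he
      rw [GradedDesignT2Aux.coeff_graded]
      exact Finset.sum_eq_zero fun t _ => Finset.sum_eq_zero fun T _ => if_neg fun hT => hex ⟨T, hT⟩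
  · rintro ⟨J, hJ, rfl⟩
    rw [coeff_cyclic_subsetSum hq ζ hζ r g d hdis J, if_pos hJ, mul_one]
    exact hpow J

end CyclicT2InstanceAux

/-- **The cyclic T2-instance (cyclic twin of the level-set reduction).**  If the binomial normal form
inequality T2 holds with exponent `b` — every sum of `K` scalar multiples of products of `N` binomials
`1 − ρ_{lj} X^{d_j}` over a common exponent list has at most `(K N + 2)^b` Newton vertices — then on a
dissociated exponent list `d` every cyclic level set `X_{r mod q} = {Σ_J d_j : Σ_J g_j ≡ r (mod q)}` (`q ≥ 1`)
has at most `(q N + 2)^b` hull vertices.  Proof: for a primitive `q`-th root of unity `ζ` the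
residue-isolating cyclic design `Σ_{t<q} ζ^{−t r}/q · Π_j (1 − (ζ^t)^{g_j} X^{d_j})` (`K = q` products) has
coefficient `±[Σ_J g_j ≡ r (mod q)]` at `Σ_J d_j` by character orthogonality, hence support exactly
`X_{r mod q}`, and `hT2` bounds its vertex count. [folklore] -/
theorem stub_cyclicT2Instance (b : ℕ)
    (hT2 : ∀ (K N : ℕ) (c : Fin K → ℂ) (ρ : Fin K → Fin N → ℂ) (d : Fin N → (Fin 2 →₀ ℕ)),
      vert (∑ l, C (c l) * ∏ j, (1 - C (ρ l j) * monomial (d j) 1)) ≤ (K * N + 2) ^ b)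
    (N q r : ℕ) (hq : 1 ≤ q) (g : Fin N → ℕ) (d : Fin N → (Fin 2 →₀ ℕ))
    (hdis : ∀ J J' : Finset (Fin N), ∑ j ∈ J, d j = ∑ j ∈ J', d j → J = J') :
    (Set.extremePoints ℝ (convexHull ℝ ((fun e : Fin 2 →₀ ℕ => fun i : Fin 2 => ((e i : ℕ) : ℝ)) ''
      (((Finset.univ.filter fun J : Finset (Fin N) => (∑ j ∈ J, g j) % q = r % q).image
        fun J => ∑ j ∈ J, d j : Finset (Fin 2 →₀ ℕ)) : Set (Fin 2 →₀ ℕ))))).ncard ≤ (q * N + 2) ^ b := by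
  -- a primitive `q`-th root of unity
  obtain ⟨ζ, hζ⟩ : ∃ ζ : ℂ, IsPrimitiveRoot ζ q := ⟨_, Complex.isPrimitiveRoot_exp q (by omega)⟩
  -- T2 for the residue-isolating cyclic design (`K = q` products), whose support is exactly `X_{r mod q}`.
  have key : vert (∑ t : Fin q, C (ζ⁻¹ ^ ((t : ℕ) * r) / (q : ℂ)) *
      ∏ j, (1 - C ((ζ ^ (t : ℕ)) ^ g j * 1) * monomial (d j) 1)) ≤ (q * N + 2) ^ b :=
    hT2 q N (fun t => ζ⁻¹ ^ ((t : ℕ) * r) / (q : ℂ)) (fun t j => (ζ ^ (t : ℕ)) ^ g j * 1) d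
  unfold vert at key
  rwa [CyclicT2InstanceAux.support_cyclic_design hq ζ hζ r g d hdis] at key

end Summit.ValiantsHypothesis.ValiantsHypothesis.Theorems.NewtonUnitEquationsNewtonTauWeak

end
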